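import Summits.QuantumFields.BalabanUV.Beta.MultiscalePartitionNormalize

/-!
# Beta / MultiscalePartitionSecondDiff — NODE (w4-a), SECOND HALF: SECOND DIFFERENCES OF THE NORMALISED PARTITION OF UNITY
# `h_z = h̃_z/√(Σ_w h̃_w²)` ARE CONTROLLED SITEWISE BY THE LOCAL FIRST AND SECOND DIFFERENCES OF THE BUMPS (MODEL;
# generic finite real analysis, the SHAPE of the `Δh`-datum of [B5] (1.121) / [B6] (2.36), (2.40))

Gen 8's `MultiscalePartitionNormalize.abs_puNorm_sub_le` bounds the FIRST differences of the normalised family; node (w4-b)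
(`MultiscaleRemainderL2.l2Bound_remK_dirInv`) consumes in addition the lattice Laplacian `|Δ_c h| ≤ Θ₂` of each bump, so the
normalisation calculus is needed one order higher.  For three points `x⁻, x, x⁺` (two consecutive bonds of one axis) with the
floor `m₀ ≤ Σ_w h̃_w²` at all three, at most `k` indices active at any of them, first differences `≤ ḡ` and second differences
`≤ ḡ₂` of the active bumps along `x⁻, x, x⁺`:
**`|h_z(x⁺) − 2h_z(x) + h_z(x⁻)| ≤ (1 + √k)·ḡ₂/√m₀ + (2√k + 4k)·ḡ²/m₀`** (`abs_puNorm_secondDiff_le`).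
With scale-adapted bumps (`ḡ ≍ 1/(M·S)`, `ḡ₂ ≍ 1/(M·S)²`, `k ≤ 3ν`) this is `|Δh_z| ≲ 1/(M·S)²`, level-free — the `Θ₂`-datum
of (w4-b′) `MultiscaleParametrixTorus.remainder_le_torus_adapted`.  Route: the four-term decomposition of the second
difference of a quotient `u/N` (`secondDiff_div_eq`), the reverse triangle inequalities for `N = √(Σ h̃_w²)` and the
CURVATURE bound of the Euclidean norm `‖a‖ + ‖c‖ − ‖a + c‖ ≤ ‖a − c‖²/(‖a‖ + ‖c‖)` (`vnorm_defect_le`), whence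
`|N⁺ − 2N + N⁻| ≤ ‖δ²h̃‖ + ‖h̃⁺ − h̃⁻‖²/(2√m₀)` (`abs_secondDiff_vnorm_le`)
(unit `b2b-balaban-beta-d4-p2`, GEN 9, MODEL crew; O.2 skeleton v1.4.1 §8.9 (K′) «WHAT (w4-a) STILL NEEDS»).

HONEST FRAMING: discharging `BetaPertH` makes Bałaban's UV stability UNCONDITIONAL — NOT the continuum limit, NOT the
Clay problem.  HONEST DEPENDENCY (verbatim): «continuum YM on T⁴ ⇐ BetaPertH ∧ nine spine estimates (0/9 proved);
BetaPertH ⇐ (D1) ∧ (D4) ∧ CAP+tail; G-an2-4 gates asym, D1 and NE2/3/4.»  THIS MODULE DISCHARGES NOTHING of `BetaPertH`,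
asserts NOTHING printed and cites nothing as a fact (ABSOLUTE RULE): [folklore] real analysis on a finite index set; bumps,
floor, increments are DATA (the EXISTENCE of scale-adapted bumps on a concrete graded cell family is node (w4-a′), open).
LOCI (shape only): [B5] = `Balaban1984PropagatorsI` (1.118) p. 37, (1.121) p. 37; [B6] = `Balaban1984PropagatorsII` (2.36),
(2.40) pp. 229–230.  No class change on row D4 (critical-path width 0; D4 DISCHARGE NO DATE); NOT BetaPertH, NOT
continuum, NOT Clay, NOT summit progress.
-/

namespace Summit.QuantumFields.BalabanUV.Beta.MultiscalePartitionSecondDiff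

open Finset
open Summit.QuantumFields.BalabanUV.Beta.MultiscalePartitionNormalize

noncomputable section

variable {X Z : Type} [Fintype Z]

/-! ## §1  The Euclidean norm on a finite index set: triangle, reverse triangle, curvature -/

/-- The Euclidean norm `‖a‖ = √(Σ_z a_z²)` of a real vector on the finite index set. [folklore] -/
def vnorm (a : Z → ℝ) : ℝ := Real.sqrt (∑ z, a z ^ 2)

/-- [folklore] -/
theorem vnorm_nonneg (a : Z → ℝ) : 0 ≤ vnorm a := Real.sqrt_nonneg _

/-- [folklore] -/
theorem sq_vnorm (a : Z → ℝ) : vnorm a ^ 2 = ∑ z, a z ^ 2 := Real.sq_sqrt (sum_nonneg fun _ _ => sq_nonneg _)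

/-- One component is dominated by the norm. [folklore] -/
theorem abs_le_vnorm (a : Z → ℝ) (z : Z) : |a z| ≤ vnorm a := by
  rw [vnorm, ← Real.sqrt_sq_eq_abs]
  exact Real.sqrt_le_sqrt (Finset.single_le_sum (f := fun w => a w ^ 2) (fun _ _ => sq_nonneg _) (mem_univ z))

/-- Minkowski: `‖a + b‖ ≤ ‖a‖ + ‖b‖` (from gen-8's Cauchy–Schwarz `sum_mul_le_sqrt_mul_sqrt`). [folklore] -/
theorem vnorm_add_le (a b : Z → ℝ) : vnorm (fun z => a z + b z) ≤ vnorm a + vnorm b := by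
  have hcs := sum_mul_le_sqrt_mul_sqrt a b
  have h0 : 0 ≤ vnorm a + vnorm b := add_nonneg (vnorm_nonneg a) (vnorm_nonneg b)
  have h : ∑ z, (a z + b z) ^ 2 ≤ (vnorm a + vnorm b) ^ 2 := by
    have e : ∑ z, (a z + b z) ^ 2 = ∑ z, a z ^ 2 + ∑ z, b z ^ 2 + 2 * ∑ z, a z * b z := by
      rw [Finset.mul_sum, ← Finset.sum_add_distrib, ← Finset.sum_add_distrib]
      exact Finset.sum_congr rfl fun z _ => by ring
    rw [e, add_sq, sq_vnorm, sq_vnorm]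
    have : 2 * ∑ z, a z * b z ≤ 2 * vnorm a * vnorm b := by rw [mul_assoc]; exact mul_le_mul_of_nonneg_left hcs (by norm_num)
    linarith
  rw [vnorm, ← Real.sqrt_sq h0]
  exact Real.sqrt_le_sqrt h

/-- Reverse triangle inequality `|‖a‖ − ‖b‖| ≤ ‖a − b‖` (gen-8 `abs_sqrt_sub_sqrt_le` BY NAME). [folklore] -/
theorem abs_vnorm_sub_vnorm_le (a b : Z → ℝ) : |vnorm a - vnorm b| ≤ vnorm (fun z => a z - b z) :=
  abs_sqrt_sub_sqrt_le a b

/-- Homogeneity for the factor `2`: `‖2b‖ = 2‖b‖`. [folklore] -/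
theorem vnorm_two_mul (b : Z → ℝ) : vnorm (fun z => 2 * b z) = 2 * vnorm b := by
  rw [vnorm, vnorm]
  have e : ∑ z, (2 * b z) ^ 2 = 2 ^ 2 * ∑ z, b z ^ 2 := by
    rw [Finset.mul_sum]; exact Finset.sum_congr rfl fun z _ => by ring
  rw [e, Real.sqrt_mul (by norm_num), Real.sqrt_sq (by norm_num)]

/-- **CURVATURE OF THE EUCLIDEAN NORM**: `‖a‖ + ‖c‖ − ‖a + c‖ ≤ ‖a − c‖²/(‖a‖ + ‖c‖)` whenever `‖a‖ + ‖c‖ > 0` (from the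
parallelogram law: `(‖a‖ + ‖c‖)² − ‖a + c‖² = ‖a − c‖² − (‖a‖ − ‖c‖)²`). [folklore] -/
theorem vnorm_defect_le (a c : Z → ℝ) (hpos : 0 < vnorm a + vnorm c) :
    vnorm a + vnorm c - vnorm (fun z => a z + c z) ≤ vnorm (fun z => a z - c z) ^ 2 / (vnorm a + vnorm c) := by
  set A := vnorm a with hA
  set C := vnorm c with hC
  set P := vnorm (fun z => a z + c z) with hP
  set Q := vnorm (fun z => a z - c z) with hQ
  have hA0 : 0 ≤ A := vnorm_nonneg a
  have hC0 : 0 ≤ C := vnorm_nonneg c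
  have hP0 : 0 ≤ P := vnorm_nonneg _
  have hPle : P ≤ A + C := vnorm_add_le a c
  -- the two expansions
  set ip := ∑ z, a z * c z with hip
  have hP2 : P ^ 2 = A ^ 2 + C ^ 2 + 2 * ip := by
    rw [hP, hA, hC, sq_vnorm, sq_vnorm, sq_vnorm, hip, Finset.mul_sum, ← Finset.sum_add_distrib, ← Finset.sum_add_distrib]
    exact Finset.sum_congr rfl fun z _ => by ring
  have hQ2 : Q ^ 2 = A ^ 2 + C ^ 2 - 2 * ip := by
    rw [hQ, hA, hC, sq_vnorm, sq_vnorm, sq_vnorm, hip, Finset.mul_sum, ← Finset.sum_add_distrib, ← Finset.sum_sub_distrib]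
    exact Finset.sum_congr rfl fun z _ => by ring
  -- (A + C − P)(A + C) ≤ (A + C − P)(A + C + P) = (A + C)² − P² = Q² − (A − C)² ≤ Q²
  have hkey : (A + C - P) * (A + C) ≤ Q ^ 2 := by
    have h1 : (A + C - P) * (A + C) ≤ (A + C - P) * (A + C + P) :=
      mul_le_mul_of_nonneg_left (by linarith) (by linarith)
    have h2 : (A + C - P) * (A + C + P) = Q ^ 2 - (A - C) ^ 2 := by nlinarith [hP2, hQ2]
    nlinarith [sq_nonneg (A - C)]
  rw [le_div_iff₀ hpos]
  exact hkey

/-- **Second difference of the norm along three points**: with `‖a‖, ‖c‖ ≥ s > 0`,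
`|‖a‖ − 2‖b‖ + ‖c‖| ≤ ‖a − 2b + c‖ + ‖a − c‖²/(2s)`. [folklore] -/
theorem abs_secondDiff_vnorm_le (a b c : Z → ℝ) {s : ℝ} (hs : 0 < s) (ha : s ≤ vnorm a) (hc : s ≤ vnorm c) :
    |vnorm a - 2 * vnorm b + vnorm c| ≤
      vnorm (fun z => a z - 2 * b z + c z) + vnorm (fun z => a z - c z) ^ 2 / (2 * s) := by
  set D := vnorm (fun z => a z - 2 * b z + c z) with hD
  have hD0 : 0 ≤ D := vnorm_nonneg _
  have hAC : 0 < vnorm a + vnorm c := by linarith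
  -- ‖a + c‖ vs 2‖b‖, both directions, through ‖(a + c) − 2b‖ = D
  have hsum_ge : 2 * vnorm b - D ≤ vnorm (fun z => a z + c z) := by
    have h := abs_vnorm_sub_vnorm_le (fun z => 2 * b z) (fun z => a z + c z)
    rw [vnorm_two_mul] at h
    have e : vnorm (fun z => 2 * b z - (a z + c z)) = D := by
      rw [hD, vnorm, vnorm]
      congr 1
      exact Finset.sum_congr rfl fun z _ => by ring
    rw [e] at h
    linarith [(abs_le.mp h).2]
  have hsum_le : vnorm (fun z => a z + c z) ≤ 2 * vnorm b + D := by
    have h := abs_vnorm_sub_vnorm_le (fun z => a z + c z) (fun z => 2 * b z)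
    rw [vnorm_two_mul] at h
    have e : vnorm (fun z => a z + c z - 2 * b z) = D := by
      rw [hD, vnorm, vnorm]
      congr 1
      exact Finset.sum_congr rfl fun z _ => by ring
    rw [e] at h
    linarith [(abs_le.mp h).2]
  -- lower bound: ‖a‖ + ‖c‖ ≥ ‖a + c‖ ≥ 2‖b‖ − D
  have hlow : -(D + vnorm (fun z => a z - c z) ^ 2 / (2 * s)) ≤ vnorm a - 2 * vnorm b + vnorm c := by
    have h1 := vnorm_add_le a c
    have h2 : 0 ≤ vnorm (fun z => a z - c z) ^ 2 / (2 * s) := by positivity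
    linarith
  -- upper bound: ‖a‖ + ‖c‖ − 2‖b‖ = defect + (‖a + c‖ − 2‖b‖) ≤ Q²/(‖a‖+‖c‖) + D ≤ Q²/(2s) + D
  have hup : vnorm a - 2 * vnorm b + vnorm c ≤ D + vnorm (fun z => a z - c z) ^ 2 / (2 * s) := by
    have h1 := vnorm_defect_le a c hAC
    have h2 : vnorm (fun z => a z - c z) ^ 2 / (vnorm a + vnorm c) ≤ vnorm (fun z => a z - c z) ^ 2 / (2 * s) :=
      div_le_div_of_nonneg_left (sq_nonneg _) (by linarith) (by linarith)
    linarith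
  exact abs_le.mpr ⟨hlow, hup⟩

/-! ## §2  Vectors supported on few indices -/

/-- A vector vanishing off a set of `≤ k` indices with entries `≤ g` in absolute value there has norm `≤ √k·g`
(gen-8 `sum_sq_sub_le` with `b = 0`). [folklore] -/
theorem vnorm_le_of_support [DecidableEq Z] (a : Z → ℝ) {k : ℕ} {P : Z → Prop} [DecidablePred P]
    (hk : (univ.filter P).card ≤ k) (hP : ∀ z, a z ≠ 0 → P z) {g : ℝ} (hg0 : 0 ≤ g) (hg : ∀ z, P z → |a z| ≤ g) :
    vnorm a ≤ Real.sqrt k * g := by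
  classical
  have hk' : (univ.filter fun z => a z ≠ 0 ∨ (fun _ : Z => (0 : ℝ)) z ≠ 0).card ≤ k := by
    refine le_trans (Finset.card_le_card fun z hz => ?_) hk
    rw [mem_filter] at hz ⊢
    rcases hz.2 with h | h
    · exact ⟨hz.1, hP z h⟩
    · exact absurd rfl h
  have hs := sum_sq_sub_le a (fun _ => (0 : ℝ)) hk' (gbar := g) fun z hz => by
    rcases hz with h | h
    · rw [sub_zero]; exact hg z (hP z h)
    · exact absurd rfl h
  simp only [sub_zero] at hs
  calc vnorm a = Real.sqrt (∑ z, a z ^ 2) := rfl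
    _ ≤ Real.sqrt (k * g ^ 2) := Real.sqrt_le_sqrt hs
    _ = Real.sqrt k * g := by rw [Real.sqrt_mul (Nat.cast_nonneg _), Real.sqrt_sq hg0]

/-! ## §3  The second difference of the normalised family -/

/-- The four-term decomposition of the second difference of a quotient `u/N` along three points (`N⁻, N, N⁺ ≠ 0`):
`u⁺/N⁺ − 2u/N + u⁻/N⁻ = (u⁺ − 2u + u⁻)/N⁺ + (u⁻ − u)(N⁺ − N⁻)/(N⁻N⁺) − u(N⁺ − 2N + N⁻)/(NN⁺) + u(N − N⁻)(N⁺ − N⁻)/(NN⁻N⁺)`.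
[folklore] -/
theorem secondDiff_div_eq {up u um Np Nn Nm : ℝ} (hNp : Np ≠ 0) (hN : Nn ≠ 0) (hNm : Nm ≠ 0) :
    up / Np - 2 * (u / Nn) + um / Nm =
      (up - 2 * u + um) / Np + (um - u) * (Np - Nm) / (Nm * Np) - u * (Np - 2 * Nn + Nm) / (Nn * Np) +
        u * (Nn - Nm) * (Np - Nm) / (Nn * Nm * Np) := by
  field_simp
  ring

/-- **SITEWISE SECOND-DIFFERENCE BOUND OF THE NORMALISED PARTITION (MODEL; node (w4-a), second half).**  Bumps `h̃` (any
sign); three points `x⁻, x, x⁺`; a floor `0 < m₀ ≤ Σ_w h̃_w²` at each of them; at most `k` indices active at any of the three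
points; for the active indices, first differences `|h̃_w(x⁺) − h̃_w(x)|, |h̃_w(x) − h̃_w(x⁻)| ≤ ḡ` and second differences
`|h̃_w(x⁺) − 2h̃_w(x) + h̃_w(x⁻)| ≤ ḡ₂` (`ḡ, ḡ₂ ≥ 0`).  Then for every index `z`:
**`|h_z(x⁺) − 2h_z(x) + h_z(x⁻)| ≤ (1 + √k)·ḡ₂/√m₀ + (2√k + 4k)·ḡ²/m₀`** — by the local data at the three points only; for
scale-adapted bumps (`ḡ ≍ 1/(M·S)`, `ḡ₂ ≍ 1/(M·S)²`) this is `|Δh_z| ≲ 1/(M·S)²`, level-free.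
[cite: Balaban1984PropagatorsI, (1.118) p.37 + (1.121) p.37; Balaban1984PropagatorsII, (2.36) p.229 + (2.40) p.230] -/
theorem abs_puNorm_secondDiff_le [DecidableEq Z] {ht : Z → X → ℝ} {m₀ : ℝ} (hm₀ : 0 < m₀) {xm x xp : X}
    (hxm : m₀ ≤ sqSum ht xm) (hx : m₀ ≤ sqSum ht x) (hxp : m₀ ≤ sqSum ht xp) (z : Z) {k : ℕ}
    (hk : (univ.filter fun w => ht w xm ≠ 0 ∨ ht w x ≠ 0 ∨ ht w xp ≠ 0).card ≤ k) {g g₂ : ℝ} (hg0 : 0 ≤ g)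
    (hg₂0 : 0 ≤ g₂)
    (hg : ∀ w, (ht w xm ≠ 0 ∨ ht w x ≠ 0 ∨ ht w xp ≠ 0) → |ht w xp - ht w x| ≤ g ∧ |ht w x - ht w xm| ≤ g)
    (hg₂ : ∀ w, (ht w xm ≠ 0 ∨ ht w x ≠ 0 ∨ ht w xp ≠ 0) → |ht w xp - 2 * ht w x + ht w xm| ≤ g₂) :
    |puNorm ht z xp - 2 * puNorm ht z x + puNorm ht z xm| ≤
      (1 + Real.sqrt k) * g₂ / Real.sqrt m₀ + (2 * Real.sqrt k + 4 * k) * g ^ 2 / m₀ := by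
  classical
  -- the three norms
  set Np := Real.sqrt (sqSum ht xp) with hNp
  set Nn := Real.sqrt (sqSum ht x) with hNn
  set Nm := Real.sqrt (sqSum ht xm) with hNm
  set s := Real.sqrt m₀ with hsdef
  have hs : 0 < s := Real.sqrt_pos.mpr hm₀
  have hs2 : s ^ 2 = m₀ := Real.sq_sqrt hm₀.le
  have hNp_ge : s ≤ Np := Real.sqrt_le_sqrt hxp
  have hNn_ge : s ≤ Nn := Real.sqrt_le_sqrt hx
  have hNm_ge : s ≤ Nm := Real.sqrt_le_sqrt hxm
  have hNp0 : 0 < Np := lt_of_lt_of_le hs hNp_ge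
  have hNn0 : 0 < Nn := lt_of_lt_of_le hs hNn_ge
  have hNm0 : 0 < Nm := lt_of_lt_of_le hs hNm_ge
  -- as Euclidean norms of the bump vectors
  have eNp : Np = vnorm fun w => ht w xp := rfl
  have eNn : Nn = vnorm fun w => ht w x := rfl
  have eNm : Nm = vnorm fun w => ht w xm := rfl
  set P : Z → Prop := fun w => ht w xm ≠ 0 ∨ ht w x ≠ 0 ∨ ht w xp ≠ 0 with hPdef
  have hsk : 0 ≤ Real.sqrt k := Real.sqrt_nonneg _
  -- norms of differences
  have hDpm : vnorm (fun w => ht w xp - ht w xm) ≤ Real.sqrt k * (2 * g) := by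
    refine vnorm_le_of_support _ hk (fun w hw => ?_) (by linarith) (fun w hw => ?_)
    · by_contra hn
      simp only [not_or, not_not] at hn
      exact hw (by rw [hn.2.2, hn.1, sub_zero])
    · obtain ⟨h1, h2⟩ := hg w hw
      calc |ht w xp - ht w xm| = |(ht w xp - ht w x) + (ht w x - ht w xm)| := by ring_nf
        _ ≤ |ht w xp - ht w x| + |ht w x - ht w xm| := abs_add_le _ _
        _ ≤ 2 * g := by linarith
  have hDpn : vnorm (fun w => ht w xp - ht w x) ≤ Real.sqrt k * g := by
    refine vnorm_le_of_support _ hk (fun w hw => ?_) hg0 (fun w hw => (hg w hw).1)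
    by_contra hn
    simp only [not_or, not_not] at hn
    exact hw (by rw [hn.2.2, hn.2.1, sub_zero])
  have hDnm : vnorm (fun w => ht w x - ht w xm) ≤ Real.sqrt k * g := by
    refine vnorm_le_of_support _ hk (fun w hw => ?_) hg0 (fun w hw => (hg w hw).2)
    by_contra hn
    simp only [not_or, not_not] at hn
    exact hw (by rw [hn.2.1, hn.1, sub_zero])
  have hD2 : vnorm (fun w => ht w xp - 2 * ht w x + ht w xm) ≤ Real.sqrt k * g₂ := by
    refine vnorm_le_of_support _ hk (fun w hw => ?_) hg₂0 (fun w hw => hg₂ w hw)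
    by_contra hn
    simp only [not_or, not_not] at hn
    exact hw (by rw [hn.2.2, hn.2.1, hn.1]; ring)
  -- differences of the norms
  have hN_pm : |Np - Nm| ≤ Real.sqrt k * (2 * g) := (abs_vnorm_sub_vnorm_le _ _).trans hDpm
  have hN_nm : |Nn - Nm| ≤ Real.sqrt k * g := (abs_vnorm_sub_vnorm_le _ _).trans hDnm
  have hN_2 : |Np - 2 * Nn + Nm| ≤ Real.sqrt k * g₂ + (Real.sqrt k * (2 * g)) ^ 2 / (2 * s) := by
    have h := abs_secondDiff_vnorm_le (fun w => ht w xp) (fun w => ht w x) (fun w => ht w xm) hs hNp_ge hNm_ge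
    rw [← eNp, ← eNn, ← eNm] at h
    refine h.trans (add_le_add hD2 ?_)
    exact div_le_div_of_nonneg_right (pow_le_pow_left₀ (vnorm_nonneg _) hDpm 2) (by linarith)
  -- the z-components
  set up := ht z xp with hup
  set u := ht z x with hu
  set um := ht z xm with hum
  have hu2 : |up - 2 * u + um| ≤ g₂ := by
    by_cases hz : P z
    · exact hg₂ z hz
    · simp only [hPdef, not_or, not_not] at hz
      rw [hup, hu, hum, hz.2.2, hz.2.1, hz.1]
      norm_num [hg₂0]
  have hu1 : |um - u| ≤ g := by
    by_cases hz : P z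
    · rw [abs_sub_comm]; exact (hg z hz).2
    · simp only [hPdef, not_or, not_not] at hz
      rw [hu, hum, hz.2.1, hz.1, sub_zero, abs_zero]
      exact hg0
  have huN : |u / Nn| ≤ 1 := by
    have := abs_puNorm_le_one ht z x
    rwa [puNorm, ← hNn] at this
  -- the decomposition
  have hdec := secondDiff_div_eq (up := up) (u := u) (um := um) hNp0.ne' hNn0.ne' hNm0.ne'
  have e0 : puNorm ht z xp - 2 * puNorm ht z x + puNorm ht z xm = up / Np - 2 * (u / Nn) + um / Nm := by
    simp only [puNorm, hup, hu, hum, hNp, hNn, hNm]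
  rw [e0, hdec]
  -- term bounds
  have T1 : |(up - 2 * u + um) / Np| ≤ g₂ / s := by
    rw [abs_div, abs_of_pos hNp0]
    exact div_le_div₀ hg₂0 hu2 hs hNp_ge
  have T2 : |(um - u) * (Np - Nm) / (Nm * Np)| ≤ g * (Real.sqrt k * (2 * g)) / (s * s) := by
    rw [abs_div, abs_mul, abs_of_pos (mul_pos hNm0 hNp0)]
    exact div_le_div₀ (by positivity) (mul_le_mul hu1 hN_pm (abs_nonneg _) hg0) (mul_pos hs hs)
      (mul_le_mul hNm_ge hNp_ge hs.le hNm0.le)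
  have T3 : |u * (Np - 2 * Nn + Nm) / (Nn * Np)| ≤
      (Real.sqrt k * g₂ + (Real.sqrt k * (2 * g)) ^ 2 / (2 * s)) / s := by
    have e : u * (Np - 2 * Nn + Nm) / (Nn * Np) = (u / Nn) * ((Np - 2 * Nn + Nm) / Np) := by
      field_simp
    rw [e, abs_mul, abs_div (Np - 2 * Nn + Nm) Np, abs_of_pos hNp0]
    calc |u / Nn| * (|Np - 2 * Nn + Nm| / Np) ≤ 1 * ((Real.sqrt k * g₂ + (Real.sqrt k * (2 * g)) ^ 2 / (2 * s)) / s) := by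
          refine mul_le_mul huN (div_le_div₀ (by positivity) hN_2 hs hNp_ge) (by positivity) zero_le_one
      _ = _ := one_mul _
  have T4 : |u * (Nn - Nm) * (Np - Nm) / (Nn * Nm * Np)| ≤ (Real.sqrt k * g) * (Real.sqrt k * (2 * g)) / (s * s) := by
    have e : u * (Nn - Nm) * (Np - Nm) / (Nn * Nm * Np) = (u / Nn) * ((Nn - Nm) * (Np - Nm) / (Nm * Np)) := by
      field_simp
    rw [e, abs_mul, abs_div _ (Nm * Np), abs_mul (Nn - Nm), abs_of_pos (mul_pos hNm0 hNp0)]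
    calc |u / Nn| * (|Nn - Nm| * |Np - Nm| / (Nm * Np))
        ≤ 1 * ((Real.sqrt k * g) * (Real.sqrt k * (2 * g)) / (s * s)) := by
          refine mul_le_mul huN ?_ (by positivity) zero_le_one
          exact div_le_div₀ (by positivity) (mul_le_mul hN_nm hN_pm (abs_nonneg _) (by positivity)) (mul_pos hs hs)
            (mul_le_mul hNm_ge hNp_ge hs.le hNm0.le)
      _ = _ := one_mul _
  -- assemble
  have hk2 : Real.sqrt k * Real.sqrt k = k := Real.mul_self_sqrt (Nat.cast_nonneg k)
  calc |(up - 2 * u + um) / Np + (um - u) * (Np - Nm) / (Nm * Np) - u * (Np - 2 * Nn + Nm) / (Nn * Np) +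
          u * (Nn - Nm) * (Np - Nm) / (Nn * Nm * Np)|
      ≤ |(up - 2 * u + um) / Np| + |(um - u) * (Np - Nm) / (Nm * Np)| + |u * (Np - 2 * Nn + Nm) / (Nn * Np)| +
          |u * (Nn - Nm) * (Np - Nm) / (Nn * Nm * Np)| := by
        refine (abs_add_le _ _).trans (add_le_add ((abs_sub _ _).trans (add_le_add (abs_add_le _ _) le_rfl)) le_rfl)
    _ ≤ g₂ / s + g * (Real.sqrt k * (2 * g)) / (s * s) +
          (Real.sqrt k * g₂ + (Real.sqrt k * (2 * g)) ^ 2 / (2 * s)) / s +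
          (Real.sqrt k * g) * (Real.sqrt k * (2 * g)) / (s * s) := add_le_add (add_le_add (add_le_add T1 T2) T3) T4
    _ = (1 + Real.sqrt k) * g₂ / s + (2 * Real.sqrt k + 4 * k) * g ^ 2 / s ^ 2 := by
        have hsq : (Real.sqrt k * (2 * g)) ^ 2 = 4 * k * g ^ 2 := by
          rw [mul_pow, Real.sq_sqrt (Nat.cast_nonneg k)]; ring
        have hkk : (Real.sqrt k * g) * (Real.sqrt k * (2 * g)) = 2 * k * g ^ 2 := by
          calc (Real.sqrt k * g) * (Real.sqrt k * (2 * g)) = 2 * (Real.sqrt k * Real.sqrt k) * g ^ 2 := by ring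
            _ = 2 * k * g ^ 2 := by rw [hk2]
        rw [hsq, hkk]
        field_simp
        ring
    _ = (1 + Real.sqrt k) * g₂ / Real.sqrt m₀ + (2 * Real.sqrt k + 4 * k) * g ^ 2 / m₀ := by rw [hs2]

end

end Summit.QuantumFields.BalabanUV.Beta.MultiscalePartitionSecondDiff
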